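import Summits.BirchSwinnertonDyer.Rank1Residual.F1Sign2.LocalTowerSignLawAtTwo
import HarnessLib

/-!
# Cell `bsd-f1-sign2`, IMC-LTS glue: `SignLawSplitsAtTwo` IS A THEOREM — `signLawSplitsAtTwo_holds`
# (LTS + FEP ⇒ SIGN on `n ≥ 2`, `f₂ ≤ 2n + 2`), via the resultant rescaling lemma
# `ℓ′_n(C c · P) = φ(2^n)·v₂(c) + ℓ′_n(P)`

PROOF FILE (seat `-ty` g10, «discharge when cheap»; statement file `F1Sign2/LocalTowerSignLawAtTwo.lean` p636363 = -imc g8 SketchG8LTS,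
REF1 §106 / §110 certified).  THEOREMS ONLY (no `def`, no `sorry`, standard axioms).  The statement file left `SignLawSplitsAtTwo` as a
`Prop` because its only non-logical input — the rescaling law of the new-part valuation `newPartNormTwoVal n P = v₂ Res(Φ_{2^n}(X+1), P)` —
was «prover work»; it is Mathlib's `Polynomial.resultant_C_mul_right` (`Res(f, C r · g) = r^{deg f}·Res(f, g)`) with
`deg Φ_{2^n}(X+1) = φ(2^n) = 2^{n−1}`, even for `n ≥ 2`, plus `padicValRat.mul/pow`; the degenerate case `Res = 0` gives `0 = 0`.
The parity algebra LTS ⊕ FEP ⇒ SIGN is REF1 §106 Probe106.lean 7989122e9b22b7c3 `e5_glue_of_rescaling` (kernel, modulo exactly this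
rescaling hypothesis), lifted verbatim with its two auxiliary lemmas e1′ (`N′` odd) and e2 (`χ₈(odd) = ±1`).
* `natDegree_cyclotomicTwoPow_comp` — `natDegree (Φ_{2^n} ∘ (X+1)) = φ(2^n)`.
* `resultant_cyclotomicTwoPow_C_mul` — `Res(Φ_{2^n}(X+1), C c · P) = c^{φ(2^n)} · Res(Φ_{2^n}(X+1), P)` for `c ≠ 0` (default degree
  arguments; `natDegree (C c · P) = natDegree P`).
* `newPartNormTwoVal_C_mul` — `ℓ′_n(C c · P) = φ(2^n)·v₂(c) + ℓ′_n(P)` when the resultant is non-zero.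
* `even_newPartNormTwoVal_C_mul_sub` — `ℓ′_n(C c · P) ≡ ℓ′_n(P) (mod 2)` for `c ≠ 0`, `n ≥ 2`, EVERY `P` (the PIN-FREE sentence of
  IMC-FEP's docstring, now kernel).
* `signLawSplitsAtTwo_holds : SignLawSplitsAtTwo`.
Consequence by name: `additiveNewPartSignLawAtTwoFrom2_of (hLTS) (hFEP) : AdditiveNewPartSignLawAtTwoFrom2` — the SIGN law of record on
`n ≥ 2` follows from the two conjecture-grade / print-assembly rows with no further input.
PARTITION: none moved (glue only; IMC-LTS `LocalTowerSignLawAtTwo` stays `@[conjecture]`, IMC-FEP print-assembly, unproved in the tree);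
beyond-print theorem: no.  BSD is not proved by any of this.
-/

set_option autoImplicit false

noncomputable section

open scoped Classical MatrixGroups ModularForm NumberField

open CongruenceSubgroup Polynomial WeierstrassCurve Literature.NumberTheory.EllipticCurves
  Literature.NumberTheory.EllipticCurves.ModularForms
  Literature.NumberTheory.EllipticCurves.Rank1Residual ZpExtension IsDedekindDomain

namespace Summit.BirchSwinnertonDyer.Rank1Residual.F1Sign2

/-! ### The resultant rescaling lemma -/

/-- `deg (Φ_{2^n} ∘ (X + 1)) = φ(2^n)`. -/
theorem natDegree_cyclotomicTwoPow_comp (n : ℕ) :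
    ((cyclotomic (2 ^ n) ℚ).comp (X + 1)).natDegree = Nat.totient (2 ^ n) := by
  rw [natDegree_comp, natDegree_cyclotomic, show ((X : ℚ[X]) + 1) = X + C 1 by rw [C_1], natDegree_X_add_C, mul_one]

/-- `φ(2^n) = 2^{n-1}` is even for `n ≥ 2`. -/
theorem even_totient_two_pow {n : ℕ} (hn : 2 ≤ n) : Even (Nat.totient (2 ^ n)) := by
  rw [Nat.totient_prime_pow Nat.prime_two (by omega)]
  refine (Nat.even_pow.mpr ⟨even_two, by omega⟩).mul_right _

/-- `Res(Φ_{2^n}(X+1), C c · P) = c^{φ(2^n)} · Res(Φ_{2^n}(X+1), P)` (`c ≠ 0`; Mathlib `resultant_C_mul_right` with the default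
degree arguments aligned by `natDegree_C_mul`). -/
theorem resultant_cyclotomicTwoPow_C_mul (n : ℕ) {c : ℚ} (hc : c ≠ 0) (P : ℚ[X]) :
    resultant ((cyclotomic (2 ^ n) ℚ).comp (X + 1)) (C c * P)
      = c ^ Nat.totient (2 ^ n) * resultant ((cyclotomic (2 ^ n) ℚ).comp (X + 1)) P := by
  rw [show (C c * P).natDegree = P.natDegree from natDegree_C_mul hc, resultant_C_mul_right,
    natDegree_cyclotomicTwoPow_comp]

/-- **Resultant rescaling**: `ℓ′_n(C c · P) = φ(2^n)·v₂(c) + ℓ′_n(P)` whenever the resultant is non-zero. -/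
theorem newPartNormTwoVal_C_mul (n : ℕ) {c : ℚ} (hc : c ≠ 0) (P : ℚ[X])
    (hR : resultant ((cyclotomic (2 ^ n) ℚ).comp (X + 1)) P ≠ 0) :
    newPartNormTwoVal n (C c * P) = (Nat.totient (2 ^ n) : ℤ) * padicValRat 2 c + newPartNormTwoVal n P := by
  unfold newPartNormTwoVal
  rw [resultant_cyclotomicTwoPow_C_mul n hc P, padicValRat.mul (pow_ne_zero _ hc) hR, padicValRat.pow]

/-- **PIN-FREENESS (mod 2)**: `ℓ′_n(C c · P) ≡ ℓ′_n(P) (mod 2)` for `c ≠ 0`, `n ≥ 2` and every `P` (if the resultant vanishes both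
sides are the junk `v₂(0) = 0`). -/
theorem even_newPartNormTwoVal_C_mul_sub (n : ℕ) (hn : 2 ≤ n) {c : ℚ} (hc : c ≠ 0) (P : ℚ[X]) :
    Even (newPartNormTwoVal n (C c * P) - newPartNormTwoVal n P) := by
  by_cases hR : resultant ((cyclotomic (2 ^ n) ℚ).comp (X + 1)) P = 0
  · have h0 : newPartNormTwoVal n (C c * P) = 0 := by
      unfold newPartNormTwoVal
      rw [resultant_cyclotomicTwoPow_C_mul n hc P, hR, mul_zero, padicValRat.zero]
    have h1 : newPartNormTwoVal n P = 0 := by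
      unfold newPartNormTwoVal
      rw [hR, padicValRat.zero]
    rw [h0, h1, sub_zero]
    exact Even.zero
  · rw [newPartNormTwoVal_C_mul n hc P hR, add_sub_cancel_right]
    exact ((Int.even_coe_nat _).mpr (even_totient_two_pow hn)).mul_right _

/-- The Mazur–Tate instance used by the glue (REF1 Probe106 `hscale`). -/
theorem even_newPartNormTwoVal_rescale_mazurTate {N : ℕ} (f : CuspForm (Gamma0 N) 2) (c : ℚ) (n : ℕ)
    (hc : c ≠ 0) (hn : 2 ≤ n) :
    Even (newPartNormTwoVal n (C c * mazurTateElement f 2 n) - newPartNormTwoVal n (mazurTateElement f 2 n)) :=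
  even_newPartNormTwoVal_C_mul_sub n hn hc _

/-! ### The parity algebra (REF1 Probe106 e1′, e2, e5, lifted) -/

/-- `N′ = N / 2^{f₂}` is odd as soon as `N ≠ 0` (REF1 Probe106 e1). -/
theorem odd_oddConductorPart_of_ne_zero (W : WeierstrassCurve ℚ) (hN : W.conductorNorm ℤ ≠ 0) :
    Odd (oddConductorPart W) := by
  have h := Nat.not_dvd_ordCompl Nat.prime_two hN
  rw [Nat.odd_iff]
  unfold oddConductorPart conductorExponentAtTwo
  omega

/-- For an ELLIPTIC `W` the conductor is positive, so `N′` is odd (REF1 Probe106 e1′). -/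
theorem odd_oddConductorPart (W : WeierstrassCurve ℚ) [W.IsElliptic] : Odd (oddConductorPart W) :=
  odd_oddConductorPart_of_ne_zero W (W.conductorNorm_pos_holds).ne'

/-- `χ₈` of an odd natural number is `±1` (REF1 Probe106 e2). -/
theorem χ₈_natCast_eq_one_or_of_odd (m : ℕ) (hm : Odd m) :
    ZMod.χ₈ (m : ZMod 8) = 1 ∨ ZMod.χ₈ (m : ZMod 8) = -1 := by
  rw [ZMod.χ₈_nat_eq_if_mod_eight]
  have h2 : m % 2 = 1 := Nat.odd_iff.mp hm
  have : m % 2 ≠ 0 := by omega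
  simp only [this, if_false]
  split_ifs <;> simp

/-- `ρ₂(W) = twoAdicTwistSign W ∈ {±1}` for every elliptic `W` — no junk branch (REF1 Probe106 e2′). -/
theorem twoAdicTwistSign_eq_one_or (W : WeierstrassCurve ℚ) [W.IsElliptic] :
    twoAdicTwistSign W = 1 ∨ twoAdicTwistSign W = -1 := by
  unfold twoAdicTwistSign
  rcases W.rootNumber_eq_one_or with h1 | h1 <;>
  rcases (W.quadraticTwist 2).rootNumber_eq_one_or with h2 | h2 <;>
  rcases χ₈_natCast_eq_one_or_of_odd _ (odd_oddConductorPart W) with h3 | h3 <;>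
  simp [h1, h2, h3]

/-- **The glue is a theorem: LTS + FEP ⇒ SIGN on `n ≥ 2`, `f₂ ≤ 2n + 2`.**  Parity arithmetic `R_n = ℓ′_n − J_n`,
`Even(J_n + X_n) ↔ ρ₂ = 1` (LTS), `Even(ℓ′_n(θ_n) + X_n) ↔ χ₈(N′) = 1` (FEP), `ℓ′_n(C ϖ·θ_n) ≡ ℓ′_n(θ_n)` (rescaling, `n ≥ 2`),
all signs in `{±1}` (REF1 Probe106 e5 verbatim with `hscale` discharged). -/
theorem signLawSplitsAtTwo_holds : SignLawSplitsAtTwo := by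
  intro hLTS hFEP N _ f W _ ϖ hϖ hf h4 κ hκ n hn hf2 hadd1 hadd2 hθ
  have h1 := hLTS W h4 κ hκ n hn hf2 hadd1 hadd2
  have h2 := hFEP f W hf h4 n hn hf2 hθ
  have h3 := even_newPartNormTwoVal_rescale_mazurTate f ϖ n hϖ hn
  rw [additiveNewPartIndex_eq_sub_towerCorrectionJump]
  have hρ : twoAdicTwistSign W
      = W.rootNumber * (W.quadraticTwist 2).rootNumber * ZMod.χ₈ (oddConductorPart W : ZMod 8) := rfl
  simp only [Int.even_iff] at h1 h2 h3 ⊢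
  rcases W.rootNumber_eq_one_or with hw | hw <;>
  rcases (W.quadraticTwist 2).rootNumber_eq_one_or with hw2 | hw2 <;>
  rcases χ₈_natCast_eq_one_or_of_odd _ (odd_oddConductorPart W) with hc | hc <;>
  simp only [hw, hw2, hc, hρ] at h1 h2 ⊢ <;>
  norm_num at h1 h2 ⊢ <;>
  omega

/-- By name: the SIGN law of record on `n ≥ 2` from the two rows. -/
theorem additiveNewPartSignLawAtTwoFrom2_of (hLTS : LocalTowerSignLawAtTwo) (hFEP : NewPartPhaseLawAtTwo) :
    AdditiveNewPartSignLawAtTwoFrom2 :=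
  signLawSplitsAtTwo_holds hLTS hFEP

example : SignLawSplitsAtTwo := signLawSplitsAtTwo_holds

end Summit.BirchSwinnertonDyer.Rank1Residual.F1Sign2

end
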